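import Literature.Probability.Distributions.HypoexponentialTail
import Literature.Probability.Distributions.GaussianPiDensity
import HarnessLib

/-!
# Knechtli–Wolff: the exact mean stochastic acceptance rate for a given spectrum

Topic `MathematicalPhysics/QuantumFieldTheory` (sequel of `PseudofermionIntegral.lean`, which holds
Knechtli–Wolff §4.1 eqs. (4.1)–(4.9): the fully stochastic determinant-ratio acceptance
`w₀(A,A') = min[1, ρ(Mη)/ρ(η)]`, one Gaussian `η` per step, is EXACT and its mean is bounded by the
"Carnot" value `min(1, |det M|⁻²)`).  A PUBLISHED RESULT, proved here (no named fact is introduced,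
D-0026); wanted by the cell pub-lqcd (venture `LatticeQCDFlow`, HOME/R2-SCOPE.md §2 row G1 and §10:
"the exact `⟨w₀⟩_η` spectral formula `Σᵢ min(1,1/λᵢ)∏_{j≠i}(λᵢ−1)/(λᵢ−λⱼ)` — not formalised, noted
for a successor").

The statement as printed.  Knechtli–Wolff, *Dynamical fermions as a global correction*, Nucl. Phys.
B 663 (2003) 3, §4.1: "We work out the dependence of `⟨w₀⟩_η = ∫D[η] min[ρ(η), ρ(Mη)]` on the
spectrum `{λᵢ}` of `M†M` with `i = 1,…,n = 2L²` for the choice `ρ = exp(−η†η)`.  Performing the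
above integration in the basis of orthonormal eigenvectors of `M†M` with components `zᵢ` we find
`⟨w₀⟩_η = ∏ᵢ (∫dzᵢdz̄ᵢ/π) min[exp(−Σᵢ|zᵢ|²), exp(−Σᵢλᵢ|zᵢ|²)]` (4.12).  Changing to polar
variables in all the complex planes we get
`⟨w₀⟩_η = ∏ᵢ (∫₀^∞ duᵢ) min[exp(−Σᵢuᵢ), exp(−Σᵢλᵢuᵢ)]` (4.13).  In appendix A this integral is
evaluated exactly yielding
`⟨w₀⟩_η = Σᵢ min(1, 1/λᵢ) ∏_{j≠i} (λᵢ − 1)/(λᵢ − λⱼ)` (4.14) … It is clear from (4.13) that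
eigenvalues `λᵢ = 1` are irrelevant for the acceptance."  Appendix A ("Acceptance rate for given
spectrum") evaluates `F(λ) = ∏_{i∈S̄}(∫₀^∞duᵢ) min[exp(−Σuᵢ), ∏_{i∈S}λᵢ⁻¹exp(−Σλᵢuᵢ)]` (A.1) for
"eigenvalues `0 < λᵢ < ∞` … assuming non degenerate `λᵢ`" by a contour integral, obtaining for
`S = ∅` (the fully stochastic case, `C = 0`, where "either closure of the contours is legitimate and
the two expressions coincide")
`F = ∏ₖλₖ⁻¹ + Σ_{λᵢ<1}(1 − 1/λᵢ)∏_{j≠i}(λᵢ−1)/(λᵢ−λⱼ) = 1 − Σ_{λᵢ>1}(1 − 1/λᵢ)∏_{j≠i}(λᵢ−1)/(λᵢ−λⱼ)`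
(A.16), and "(4.14)" from it by "the implied identity, which holds for arbitrary non-coinciding
`λᵢ`, `Σ_{i=1}^{n} (λᵢ − 1)^{n−1} ∏_{i≠j=1}^{n} 1/(λᵢ − λⱼ) = 1` (A.9) [which] can in fact also be
verified purely algebraically.  To this end we recall the Lagrange polynomials
`lᵢ(λ) = ∏_{j≠i}(λ − λⱼ)/(λᵢ − λⱼ)` …" (A.10)–(A.15).

What is proved here, and how (finite form; OUR road to the printed closed form is probabilistic,
not the residue theorem — deviation recorded): under the weights `∏ᵢ e^{−uᵢ}duᵢ` of (4.13) the `uᵢ`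
are i.i.d. `Exp(1)` variables (the law of `|zᵢ|²` for the complex Gaussian `D[η]ρ(η)` of (4.12)), so
(4.13) reads `⟨w₀⟩_η = E[min(1, exp(−Σᵢ(λᵢ − 1)uᵢ))]`; and `min(1, e^{−x}) = P{u₀ ≥ x}` for one more
`Exp(1)` variable, so that `⟨w₀⟩_η = 1 − P{u₀ + Σ_{λᵢ<1}(1−λᵢ)uᵢ < Σ_{λᵢ>1}(λᵢ−1)uᵢ}`; the right
side is the hypoexponential tail of `Literature/Probability/Distributions/HypoexponentialTail.lean`
(the `λᵢ > 1` group: independent exponentials with the pairwise distinct rates `1/(λᵢ − 1)`)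
integrated against the moment generating function of the `λᵢ < 1` group (Mathlib's
`iIndepFun.mgf_sum`).

* `kwWeight lam i = ∏_{j≠i} (λᵢ − 1)/(λᵢ − λⱼ)` and **`sum_kwWeight`** : `Σᵢ kwWeight = 1` — the
  printed identity (A.9) "verified purely algebraically" by Lagrange interpolation (A.10)–(A.15)
  (here: the hypoexponential normalisation at the nodes `1/(λⱼ − 1)`);
* `expMeasure_real_Ici` : `P{u₀ ≥ x} = min(1, e^{−x})`; `integral_exp_neg_mul_expMeasure` : the
  exponential moment `E[e^{−a u}] = r/(r + a)`; `map_const_mul_expMeasure` : `c·Exp(r) = Exp(r/c)`;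
* `measureReal_lt_eq_integral` : for independent `T`, `S`: `P{T < S} = E[φ(T)]`, `φ(t) = P{t < S}`;
* `integral_min_one_exp_neg_eq_integral` : `E[min(1, e^{−X})] = ∫ P{X ≤ v} Exp(1)(dv)`;
* **`integral_min_one_exp_neg_sum_eq_one_sub`** : (A.16), second form, at `C = 0`:
  `⟨w₀⟩_η = 1 − Σ_{λᵢ>1} (1 − 1/λᵢ) ∏_{j≠i} (λᵢ−1)/(λᵢ−λⱼ)`;
* **`integral_min_one_exp_neg_sum`** : KNECHTLI–WOLFF (4.14):
  `⟨w₀⟩_η = Σᵢ min(1, 1/λᵢ) ∏_{j≠i} (λᵢ − 1)/(λᵢ − λⱼ)`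
  for `0 < λᵢ` pairwise distinct, `λᵢ ≠ 1`, `n ≥ 1`, on any probability space carrying independent
  `uᵢ ∼ Exp(1)`; and `integral_pi_min_one_exp_neg_sum`, the same on the product space
  `⊗ᵢ Exp(1)(duᵢ) = ∏ᵢ e^{−uᵢ}duᵢ` on `u ≥ 0` — (4.13) verbatim up to writing `e^{−Σuᵢ} min[1, ·]`
  for `min[e^{−Σuᵢ}, ·]`.

Honest scope: `λᵢ = 1` ("irrelevant for the acceptance") is excluded rather than erased; the
partially stochastic case `S ≠ ∅` (A.12 with `C ≠ 0`), the degenerate-eigenvalue limits, the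
reduction (4.11)→(4.12) (unitary diagonalisation of `M†M` inside the Gaussian integral) and the
two-eigenvalue estimate (4.15) `⟨w₀⟩_η ≈ (2 − λ₁)/λₙ` are NOT formalised — TODO(general form).

## References
* [KnechtliWolff2003] F. Knechtli, U. Wolff, Dynamical fermions as a global correction, Nucl. Phys.
  B 663 (2003) 3–32, §4.1 eqs. (4.12)–(4.14), Appendix A eqs. (A.1)–(A.18).
  (Equation numbers as PRINTED in the arXiv version hep-lat/0303001; an earlier revision of this
  docstring counted displays and was off by one in §4.1 and by up to four in Appendix A.)
* [BuchholzKriegeFelko2014] P. Buchholz, J. Kriege, I. Felko, Input Modeling with Phase-Type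
  Distributions and Markov Models, Springer 2014, Ch. 2 eq. (2.24) (hypoexponential law).
* [Feller1971] W. Feller, An Introduction to Probability Theory and Its Applications II, 2nd ed.,
  Wiley 1971, Ch. I §3 (exponential law), §13 Problem 12.
-/

namespace Literature.MathematicalPhysics.QuantumFieldTheory.StochasticAcceptance

open MeasureTheory ProbabilityTheory Set Real
open Literature.Probability.Distributions
open scoped ENNReal

/-! ## The exponential law: tail, exponential moments, scaling -/

section ExpLaw

variable {Ω : Type*} [MeasurableSpace Ω] {μ : Measure Ω}

/-- The real exponential density: `r e^{−rx}` on `x ≥ 0`, `0` on `x < 0`. [folklore] -/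
private theorem exponentialPDFReal_eq (r x : ℝ) :
    exponentialPDFReal r x = if 0 ≤ x then r * Real.exp (-(r * x)) else 0 := by
  simp only [exponentialPDFReal, gammaPDFReal, Real.rpow_one, Real.Gamma_one, div_one, sub_self,
    Real.rpow_zero, mul_one]

/-- The exponential distribution function `F(x) = 1 − e^{−rx}` (`x ≥ 0`), `0` (`x < 0`).
[cite: BuchholzKriegeFelko2014, Ch. 2 (the display before eq. (2.24))] -/
theorem expMeasure_real_Iic {r : ℝ} (hr : 0 < r) (x : ℝ) :
    (expMeasure r).real (Iic x) = if 0 ≤ x then 1 - Real.exp (-(r * x)) else 0 := by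
  haveI := isProbabilityMeasure_expMeasure hr
  rw [← cdf_eq_real, cdf_expMeasure_eq hr]

/-- The exponential law has no atoms. [folklore] -/
private theorem expMeasure_singleton (r x : ℝ) : expMeasure r {x} = 0 := by
  rw [Hypoexponential.expMeasure_eq_withDensity]
  exact withDensity_absolutelyContinuous _ _ Real.volume_singleton

/-- The exponential law lives on `[0, ∞)`. [folklore] -/
private theorem ae_nonneg_expMeasure (r : ℝ) : ∀ᵐ v ∂(expMeasure r), (0 : ℝ) ≤ v := by
  rw [ae_iff]
  have : {v : ℝ | ¬ 0 ≤ v} = Iio 0 := by ext v; simp [not_le]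
  rw [this, Hypoexponential.expMeasure_eq_withDensity, withDensity_apply _ measurableSet_Iio]
  exact lintegral_exponentialPDF_of_nonpos le_rfl

/-- **The exponential tail as the Metropolis filter**: for `u ∼ Exp(r)`,
`P{u ≥ x} = min(1, e^{−rx})` for every real `x` (for `r = 1`: `min(1, e^{−x})`, the function under
the `η`-average in `⟨w₀⟩_η = ∫D[η] min[1, ρ(Mη)/ρ(η)]`).
[cite: KnechtliWolff2003, §4.1 eqs. (4.7), (4.13)]; [cite: BuchholzKriegeFelko2014, Ch. 2 (before (2.24))] -/
theorem expMeasure_real_Ici {r : ℝ} (hr : 0 < r) (x : ℝ) :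
    (expMeasure r).real (Ici x) = min 1 (Real.exp (-(r * x))) := by
  haveI := isProbabilityMeasure_expMeasure hr
  have h1 : (expMeasure r).real (Ici x) = 1 - (expMeasure r).real (Iio x) := by
    rw [← compl_Iio, measureReal_compl measurableSet_Iio, probReal_univ]
  have h2 : (expMeasure r).real (Iio x) = (expMeasure r).real (Iic x) :=
    measureReal_congr (Iio_ae_eq_Iic' (expMeasure_singleton r x))
  rw [h1, h2, expMeasure_real_Iic hr]
  split_ifs with h
  · have hle : Real.exp (-(r * x)) ≤ 1 := by
      rw [Real.exp_le_one_iff]; nlinarith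
    rw [min_eq_right hle]
    ring
  · have hge : 1 ≤ Real.exp (-(r * x)) := by
      rw [Real.one_le_exp_iff]; nlinarith
    rw [min_eq_left hge]
    ring

/-- **Exponential moments of the exponential law**: for `u ∼ Exp(r)` and `a ≥ 0`,
`E[e^{−a u}] = ∫₀^∞ e^{−ax} r e^{−rx} dx = r/(r + a)`.
[cite: Feller1971, Ch. I §3 (the exponential density `αe^{−αx}`)]; [folklore] -/
theorem integral_exp_neg_mul_expMeasure {r : ℝ} (hr : 0 < r) {a : ℝ} (ha : 0 ≤ a) :
    ∫ x, Real.exp (-(a * x)) ∂(expMeasure r) = r / (r + a) := by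
  have hpdf : Measurable (exponentialPDF r) := (measurable_exponentialPDFReal r).ennreal_ofReal
  rw [Hypoexponential.expMeasure_eq_withDensity,
    integral_withDensity_eq_integral_toReal_smul hpdf
      (ae_of_all _ fun x => by simp [exponentialPDF])]
  have hF : (fun x => (exponentialPDF r x).toReal • Real.exp (-(a * x)))
      = (Ici (0 : ℝ)).indicator fun x => r * Real.exp (-(r + a) * x) := by
    funext x
    simp only [exponentialPDF, exponentialPDFReal_eq, smul_eq_mul, Set.indicator_apply, mem_Ici]
    split_ifs with h
    · rw [ENNReal.toReal_ofReal (mul_pos hr (Real.exp_pos _)).le, mul_assoc, ← Real.exp_add]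
      ring_nf
    · simp
  rw [hF, integral_indicator measurableSet_Ici, integral_Ici_eq_integral_Ioi, integral_const_mul,
    integral_exp_mul_Ioi (by linarith) 0]
  have : r + a ≠ 0 := by linarith
  field_simp
  simp

/-- **Scaling**: for `u ∼ Exp(r)` and `c > 0`, `c·u ∼ Exp(r/c)` (compare the distribution functions
`1 − e^{−r x/c}`). [cite: BuchholzKriegeFelko2014, Ch. 2 (before (2.24))]; [folklore] -/
theorem map_const_mul_expMeasure {r : ℝ} (hr : 0 < r) {c : ℝ} (hc : 0 < c) :
    (expMeasure r).map (fun x => c * x) = expMeasure (r / c) := by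
  haveI := isProbabilityMeasure_expMeasure hr
  haveI := isProbabilityMeasure_expMeasure (div_pos hr hc)
  haveI : IsProbabilityMeasure ((expMeasure r).map fun x => c * x) :=
    Measure.isProbabilityMeasure_map (measurable_const_mul c).aemeasurable
  refine Measure.ext_of_Iic _ _ fun a => ?_
  have h1 : ((expMeasure r).map fun x => c * x).real (Iic a) = (expMeasure (r / c)).real (Iic a) := by
    rw [map_measureReal_apply (measurable_const_mul c) measurableSet_Iic,
      preimage_const_mul_Iic₀ a hc, expMeasure_real_Iic hr, expMeasure_real_Iic (div_pos hr hc)]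
    have hiff : 0 ≤ a / c ↔ 0 ≤ a := by
      constructor
      · intro h
        have := mul_nonneg h hc.le
        rwa [div_mul_cancel₀ a hc.ne'] at this
      · intro h; positivity
    by_cases ha : 0 ≤ a
    · rw [if_pos (hiff.mpr ha), if_pos ha]
      congr 2
      field_simp
    · rw [if_neg (fun h => ha (hiff.mp h)), if_neg ha]
  have e1 := ofReal_measureReal (μ := (expMeasure r).map fun x => c * x) (s := Iic a)
  have e2 := ofReal_measureReal (μ := expMeasure (r / c)) (s := Iic a)
  rw [← e1, ← e2, h1]

/-- For `u ∼ Exp(1)`: the scaled variable `c·u`, `c > 0`, is `Exp(1/c)`-distributed (rate form used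
for the hypoexponential tail). [cite: BuchholzKriegeFelko2014, Ch. 2 (before (2.24))]; [folklore] -/
theorem map_const_mul_of_map_eq_expMeasure_one {u : Ω → ℝ} (hu : Measurable u)
    (hlaw : μ.map u = expMeasure 1) {c : ℝ} (hc : 0 < c) :
    μ.map (fun ω => c * u ω) = expMeasure c⁻¹ := by
  have : (fun ω => c * u ω) = (fun x => c * x) ∘ u := rfl
  rw [this, ← Measure.map_map (measurable_const_mul c) hu, hlaw, map_const_mul_expMeasure one_pos hc,
    one_div]

/-- The exponential moment of `c·u`, `u ∼ Exp(1)`, `a c`-style: `E[e^{t·(c u)}] = 1/(1 − t c)` at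
`t = −a ≤ 0`, i.e. Mathlib's `mgf (c·u) μ (−a) = 1/(1 + a c)`.
[cite: Feller1971, Ch. I §3]; [folklore] -/
theorem mgf_const_mul_of_map_eq_expMeasure_one [IsProbabilityMeasure μ] {u : Ω → ℝ}
    (hu : Measurable u) (hlaw : μ.map u = expMeasure 1) {c a : ℝ} (hc : 0 ≤ c) (ha : 0 ≤ a) :
    mgf (fun ω => c * u ω) μ (-a) = 1 / (1 + a * c) := by
  unfold mgf
  have hmap := integral_map hu.aemeasurable (f := fun x => Real.exp (-((a * c) * x)))
    (μ := μ) (by fun_prop)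
  have hrew : (fun ω => Real.exp (-a * (c * u ω))) = fun ω => Real.exp (-((a * c) * u ω)) := by
    funext ω; ring_nf
  rw [hrew, ← hmap, hlaw, integral_exp_neg_mul_expMeasure one_pos (mul_nonneg ha hc)]

end ExpLaw

/-! ## Two probabilistic identities -/

section Identities

variable {Ω : Type*} [MeasurableSpace Ω] {μ : Measure Ω} [IsProbabilityMeasure μ]

/-- Measurability of the tail `t ↦ P{t < S}`. [folklore] -/
private theorem measurable_measure_lt {S : Ω → ℝ} (hS : Measurable S) :
    Measurable fun t : ℝ => μ {ω | t < S ω} := by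
  have hEm : MeasurableSet {p : ℝ × ℝ | p.1 < p.2} := measurableSet_lt measurable_fst measurable_snd
  have h := measurable_measure_prodMk_left (ν := μ.map S) hEm
  have hfun : (fun t : ℝ => μ {ω | t < S ω})
      = fun t : ℝ => (μ.map S) (Prod.mk t ⁻¹' {p : ℝ × ℝ | p.1 < p.2}) := by
    funext t
    have : Prod.mk t ⁻¹' {p : ℝ × ℝ | p.1 < p.2} = Ioi t := by ext s; simp
    rw [this, Measure.map_apply hS measurableSet_Ioi]
    rfl
  rw [hfun]
  exact h

/-- **Conditioning on the independent level**: for independent real random variables `T`, `S`,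
`P{T < S} = E[φ(T)]` with `φ(t) = P{t < S}`. [folklore] (Fubini on the product law; the device of
[cite: Feller1971, Ch. I §13 Problem 12 (hint)] applied to a random level) -/
theorem measureReal_lt_eq_integral {T S : Ω → ℝ} (hT : Measurable T) (hS : Measurable S)
    (hTS : IndepFun T S μ) :
    μ.real {ω | T ω < S ω} = ∫ ω, (fun t => μ.real {ω' | t < S ω'}) (T ω) ∂μ := by
  set E : Set (ℝ × ℝ) := {p | p.1 < p.2} with hE
  have hEm : MeasurableSet E := measurableSet_lt measurable_fst measurable_snd
  have hprod : μ.map (fun ω => (T ω, S ω)) = (μ.map T).prod (μ.map S) :=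
    (indepFun_iff_map_prod_eq_prod_map_map hT.aemeasurable hS.aemeasurable).mp hTS
  have h1 : μ {ω | T ω < S ω} = ((μ.map T).prod (μ.map S)) E := by
    rw [← hprod, Measure.map_apply (hT.prodMk hS) hEm]
    rfl
  have h2 : ((μ.map T).prod (μ.map S)) E = ∫⁻ t, μ {ω | t < S ω} ∂(μ.map T) := by
    rw [Measure.prod_apply hEm]
    refine lintegral_congr fun t => ?_
    have : Prod.mk t ⁻¹' E = Ioi t := by ext s; simp [hE]
    rw [this, Measure.map_apply hS measurableSet_Ioi]
    rfl
  have hg : Measurable fun t : ℝ => μ {ω | t < S ω} := measurable_measure_lt hS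
  set φ : ℝ → ℝ := fun t => μ.real {ω' | t < S ω'} with hφ
  have hφm : Measurable φ := hg.ennreal_toReal
  haveI : IsProbabilityMeasure (μ.map T) := Measure.isProbabilityMeasure_map hT.aemeasurable
  have hφint : Integrable φ (μ.map T) :=
    Integrable.mono' (integrable_const (1 : ℝ)) hφm.aestronglyMeasurable
      (ae_of_all _ fun t => by
        rw [Real.norm_eq_abs, abs_of_nonneg measureReal_nonneg]
        exact measureReal_le_one)
  have h3 : ∫⁻ t, μ {ω | t < S ω} ∂(μ.map T) = ENNReal.ofReal (∫ t, φ t ∂(μ.map T)) := by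
    rw [ofReal_integral_eq_lintegral_ofReal hφint (ae_of_all _ fun t => measureReal_nonneg)]
    refine lintegral_congr fun t => ?_
    rw [hφ, ofReal_measureReal]
  rw [measureReal_def, h1, h2, h3, ENNReal.toReal_ofReal (integral_nonneg fun t => measureReal_nonneg),
    integral_map hT.aemeasurable hφm.aestronglyMeasurable]

/-- **Adjoining the auxiliary exponential**: for a real random variable `X`,
`E[min(1, e^{−X})] = ∫ P{X ≤ v} Exp(1)(dv)` — both sides are the mass of `{X ≤ v}` under the
product of the law with `Exp(1)` (the reading `min(1, e^{−x}) = P{u₀ ≥ x}`).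
[cite: KnechtliWolff2003, §4.1 eq. (4.13)]; [folklore] -/
theorem integral_min_one_exp_neg_eq_integral {X : Ω → ℝ} (hX : Measurable X) :
    ∫ ω, min 1 (Real.exp (-X ω)) ∂μ = ∫ v, μ.real {ω | X ω ≤ v} ∂(expMeasure 1) := by
  haveI := isProbabilityMeasure_expMeasure (zero_lt_one' ℝ)
  set ν : Measure ℝ := expMeasure 1 with hν
  set E : Set (Ω × ℝ) := {p | X p.1 ≤ p.2} with hE
  have hEm : MeasurableSet E := measurableSet_le (hX.comp measurable_fst) measurable_snd
  -- integrate over `v` first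
  have hA : (μ.prod ν) E = ∫⁻ ω, ENNReal.ofReal (min 1 (Real.exp (-X ω))) ∂μ := by
    rw [Measure.prod_apply hEm]
    refine lintegral_congr fun ω => ?_
    have : Prod.mk ω ⁻¹' E = Ici (X ω) := by ext v; simp [hE]
    rw [this, ← ofReal_measureReal, hν, expMeasure_real_Ici one_pos, one_mul]
  -- integrate over `ω` first
  have hg : Measurable fun v : ℝ => μ ((fun ω => (ω, v)) ⁻¹' E) :=
    measurable_measure_prodMk_right hEm
  have hB : (μ.prod ν) E = ∫⁻ v, ENNReal.ofReal (μ.real {ω | X ω ≤ v}) ∂ν := by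
    rw [Measure.prod_apply_symm hEm]
    refine lintegral_congr fun v => ?_
    rw [ofReal_measureReal]
    rfl
  -- both Bochner integrals exist
  have hf1 : Integrable (fun ω => min 1 (Real.exp (-X ω))) μ :=
    Integrable.mono' (integrable_const (1 : ℝ)) (by fun_prop)
      (ae_of_all _ fun ω => by
        rw [Real.norm_eq_abs, abs_of_nonneg (le_min zero_le_one (Real.exp_pos _).le)]
        exact min_le_left _ _)
  have hg' : Measurable fun v : ℝ => μ.real {ω | X ω ≤ v} := by
    have : (fun v : ℝ => μ.real {ω | X ω ≤ v}) = fun v => (μ ((fun ω => (ω, v)) ⁻¹' E)).toReal := by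
      funext v; rfl
    rw [this]
    exact hg.ennreal_toReal
  have hf2 : Integrable (fun v => μ.real {ω | X ω ≤ v}) ν :=
    Integrable.mono' (integrable_const (1 : ℝ)) hg'.aestronglyMeasurable
      (ae_of_all _ fun v => by
        rw [Real.norm_eq_abs, abs_of_nonneg measureReal_nonneg]
        exact measureReal_le_one)
  have h1 := ofReal_integral_eq_lintegral_ofReal hf1
    (ae_of_all _ fun ω => le_min zero_le_one (Real.exp_pos _).le)
  have h2 := ofReal_integral_eq_lintegral_ofReal hf2 (ae_of_all _ fun v => measureReal_nonneg)
  have h12 : ENNReal.ofReal (∫ ω, min 1 (Real.exp (-X ω)) ∂μ)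
      = ENNReal.ofReal (∫ v, μ.real {ω | X ω ≤ v} ∂ν) := by
    rw [h1, h2, ← hA, ← hB]
  have := congrArg ENNReal.toReal h12
  rwa [ENNReal.toReal_ofReal (integral_nonneg fun ω => le_min zero_le_one (Real.exp_pos _).le),
    ENNReal.toReal_ofReal (integral_nonneg fun v => measureReal_nonneg)] at this

end Identities

/-! ## Knechtli–Wolff (4.14) -/

section KnechtliWolff

variable {ι : Type*} [Fintype ι] [DecidableEq ι]

/-- The node change `μ = 1/(λ − 1)`: `μ_b/(μ_b − μ_a) = (a − 1)/(a − b)`. [folklore] -/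
private theorem node_identity {a b : ℝ} (ha : a ≠ 1) (hb : b ≠ 1) (hab : a ≠ b) :
    (b - 1)⁻¹ / ((b - 1)⁻¹ - (a - 1)⁻¹) = (a - 1) / (a - b) := by
  have hx : a - 1 ≠ 0 := sub_ne_zero.mpr ha
  have hy : b - 1 ≠ 0 := sub_ne_zero.mpr hb
  have hxy : a - b ≠ 0 := sub_ne_zero.mpr hab
  have hden : (b - 1)⁻¹ - (a - 1)⁻¹ = (a - b) * ((a - 1)⁻¹ * (b - 1)⁻¹) := by
    calc (b - 1)⁻¹ - (a - 1)⁻¹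
        = ((a - 1) * (a - 1)⁻¹) * (b - 1)⁻¹ - ((b - 1) * (b - 1)⁻¹) * (a - 1)⁻¹ := by
          rw [mul_inv_cancel₀ hx, mul_inv_cancel₀ hy, one_mul, one_mul]
      _ = (a - b) * ((a - 1)⁻¹ * (b - 1)⁻¹) := by ring
  have hden0 : (a - b) * ((a - 1)⁻¹ * (b - 1)⁻¹) ≠ 0 :=
    mul_ne_zero hxy (mul_ne_zero (inv_ne_zero hx) (inv_ne_zero hy))
  rw [hden, div_eq_div_iff hden0 hxy]
  calc (b - 1)⁻¹ * (a - b) = (a - b) * (b - 1)⁻¹ * ((a - 1) * (a - 1)⁻¹) := by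
        rw [mul_inv_cancel₀ hx, mul_one, mul_comm]
    _ = (a - 1) * ((a - b) * ((a - 1)⁻¹ * (b - 1)⁻¹)) := by ring

/-- `1/(1 + 1/(λ − 1)) = 1 − 1/λ` for `λ ≠ 0, 1`. [folklore] -/
private theorem one_div_one_add_inv {a : ℝ} (h0 : a ≠ 0) (h1 : a ≠ 1) :
    1 / (1 + (a - 1)⁻¹) = 1 - a⁻¹ := by
  have hx : a - 1 ≠ 0 := sub_ne_zero.mpr h1
  have e2 : 1 + (a - 1)⁻¹ = a * (a - 1)⁻¹ := by
    calc 1 + (a - 1)⁻¹ = (a - 1) * (a - 1)⁻¹ + (a - 1)⁻¹ := by rw [mul_inv_cancel₀ hx]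
      _ = a * (a - 1)⁻¹ := by ring
  have hne : a * (a - 1)⁻¹ ≠ 0 := mul_ne_zero h0 (inv_ne_zero hx)
  rw [e2, div_eq_iff hne]
  have e3 : (1 - a⁻¹) * (a * (a - 1)⁻¹) = (a - a⁻¹ * a) * (a - 1)⁻¹ := by ring
  rw [e3, inv_mul_cancel₀ h0, mul_inv_cancel₀ hx]

/-- Knechtli–Wolff's spectral weight `∏_{j≠i} (λᵢ − 1)/(λᵢ − λⱼ)` of the eigenvalue `λᵢ` of `M†M`.
[cite: KnechtliWolff2003, §4.1 eq. (4.14), App. A eq. (A.8)] -/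
noncomputable def kwWeight (lam : ι → ℝ) (i : ι) : ℝ :=
  ∏ j ∈ Finset.univ.erase i, (lam i - 1) / (lam i - lam j)

/-- The spectral weight is the hypoexponential coefficient at the nodes `1/(λⱼ − 1)`:
`(λᵢ−1)/(λᵢ−λⱼ) = μⱼ/(μⱼ − μᵢ)` with `μ = 1/(λ − 1)`. [cite: KnechtliWolff2003, App. A eqs. (A.8)–(A.10)] -/
theorem kwWeight_eq_coeff {lam : ι → ℝ} (hne : ∀ i, lam i ≠ 1) (hinj : Function.Injective lam)
    (i : ι) : kwWeight lam i = Hypoexponential.coeff Finset.univ (fun j => (lam j - 1)⁻¹) i := by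
  unfold kwWeight Hypoexponential.coeff
  refine Finset.prod_congr rfl fun j hj => ?_
  have hji : j ≠ i := Finset.ne_of_mem_erase hj
  exact (node_identity (hne i) (hne j) fun h => hji (hinj h).symm).symm

/-- **(A.9) "sumlam"**: `Σᵢ ∏_{j≠i} (λᵢ − 1)/(λᵢ − λⱼ) = 1` for pairwise distinct `λᵢ ≠ 1`, `n ≥ 1`
— "verified purely algebraically" by Lagrange interpolation.
[cite: KnechtliWolff2003, App. A eqs. (A.9)–(A.15)] -/
theorem sum_kwWeight [Nonempty ι] {lam : ι → ℝ} (hne : ∀ i, lam i ≠ 1)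
    (hinj : Function.Injective lam) : ∑ i, kwWeight lam i = 1 := by
  simp_rw [kwWeight_eq_coeff hne hinj]
  refine Hypoexponential.sum_coeff_eq_one ?_ Finset.univ_nonempty
  intro a _ b _ h
  have h' : lam a - 1 = lam b - 1 := inv_injective h
  exact hinj (by linarith)

variable {Ω : Type*} [MeasurableSpace Ω] {μ : Measure Ω} [IsProbabilityMeasure μ]

/-- **Knechtli–Wolff, Appendix A (A.16) at `C = 0` (fully stochastic case `S = ∅`)**:
for independent `uᵢ ∼ Exp(1)` and eigenvalues `0 < λᵢ`, pairwise distinct, `λᵢ ≠ 1`,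
`E[min(1, exp(−Σᵢ(λᵢ − 1)uᵢ))] = 1 − Σ_{λᵢ>1} (1 − 1/λᵢ) ∏_{j≠i} (λᵢ − 1)/(λᵢ − λⱼ)`.
[cite: KnechtliWolff2003, App. A eq. (A.16) (second line, `C = 0`), eq. (4.13)] -/
theorem integral_min_one_exp_neg_sum_eq_one_sub {u : ι → Ω → ℝ} (hind : iIndepFun u μ)
    (hmeas : ∀ i, Measurable (u i)) (hlaw : ∀ i, μ.map (u i) = expMeasure 1)
    {lam : ι → ℝ} (hpos : ∀ i, 0 < lam i) (hne : ∀ i, lam i ≠ 1)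
    (hinj : Function.Injective lam) :
    ∫ ω, min 1 (Real.exp (-(∑ i, (lam i - 1) * u i ω))) ∂μ
      = 1 - ∑ i ∈ Finset.univ.filter (fun i => 1 < lam i),
          (1 - (lam i)⁻¹) * kwWeight lam i := by
  classical
  -- the two groups of eigenvalues
  set neg : Finset ι := Finset.univ.filter (fun i => 1 < lam i) with hneg
  set pos : Finset ι := Finset.univ.filter (fun i => ¬ 1 < lam i) with hpos'
  have hmem_neg : ∀ i, i ∈ neg ↔ 1 < lam i := fun i => by simp [hneg]
  have hmem_pos : ∀ i, i ∈ pos ↔ lam i < 1 := fun i => by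
    simp only [hpos', Finset.mem_filter, Finset.mem_univ, true_and, not_lt]
    exact ⟨fun h => lt_of_le_of_ne h (hne i), le_of_lt⟩
  have hdisj : Disjoint pos neg := by
    rw [disjoint_comm]; exact Finset.disjoint_filter_filter_not _ _ _
  have hunion : neg ∪ pos = Finset.univ := Finset.filter_union_filter_not_eq _ _
  -- the scaled variables and the two partial sums
  set Xn : ι → Ω → ℝ := fun i ω => (lam i - 1) * u i ω with hXn
  set Xp : ι → Ω → ℝ := fun i ω => (1 - lam i) * u i ω with hXp
  have hXn_meas : ∀ i, Measurable (Xn i) := fun i => (hmeas i).const_mul _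
  have hXp_meas : ∀ i, Measurable (Xp i) := fun i => (hmeas i).const_mul _
  have hXn_ind : iIndepFun Xn μ :=
    hind.comp (fun i x => (lam i - 1) * x) fun i => measurable_const_mul _
  have hXp_ind : iIndepFun Xp μ :=
    hind.comp (fun i x => (1 - lam i) * x) fun i => measurable_const_mul _
  set Yn : Ω → ℝ := fun ω => ∑ i ∈ neg, Xn i ω with hYn
  set Yp : Ω → ℝ := fun ω => ∑ i ∈ pos, Xp i ω with hYp
  have hYn_meas : Measurable Yn := Finset.measurable_sum neg fun i _ => hXn_meas i
  have hYp_meas : Measurable Yp := Finset.measurable_sum pos fun i _ => hXp_meas i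
  have hX_eq : ∀ ω, ∑ i, (lam i - 1) * u i ω = Yn ω - Yp ω := by
    intro ω
    rw [hYn, hYp, ← Finset.sum_filter_add_sum_filter_not Finset.univ (fun i => 1 < lam i)]
    simp only [hXn, hXp]
    rw [sub_eq_add_neg, ← Finset.sum_neg_distrib]
    congr 1
    exact Finset.sum_congr rfl fun i _ => by ring
  -- nonnegativity a.s.
  have hu_nn : ∀ᵐ ω ∂μ, ∀ i, 0 ≤ u i ω := by
    rw [ae_all_iff]
    exact fun i => Hypoexponential.ae_nonneg_of_map_eq_expMeasure (hmeas i) (hlaw i)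
  have hYp_nn : ∀ᵐ ω ∂μ, 0 ≤ Yp ω := by
    filter_upwards [hu_nn] with ω hω
    exact Finset.sum_nonneg fun i hi =>
      mul_nonneg (by have := (hmem_pos i).mp hi; linarith) (hω i)
  -- rates of the `λ > 1` group
  set r : ι → ℝ := fun i => (lam i - 1)⁻¹ with hr
  have hr_pos : ∀ i ∈ neg, 0 < r i := fun i hi => by
    have := (hmem_neg i).mp hi; simp only [hr]; exact inv_pos.mpr (by linarith)
  have hr_inj : Set.InjOn r ↑neg := by
    intro a _ b _ h
    have h' : lam a - 1 = lam b - 1 := inv_injective h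
    exact hinj (by linarith)
  have hXn_law : ∀ i ∈ neg, μ.map (Xn i) = expMeasure (r i) := fun i hi =>
    map_const_mul_of_map_eq_expMeasure_one (hmeas i) (hlaw i) (by have := (hmem_neg i).mp hi; linarith)
  -- the tail of the `λ > 1` group (hypoexponential)
  have htail : ∀ t, 0 ≤ t → μ.real {ω | t < Yn ω} = Hypoexponential.tail neg r t := by
    intro t ht
    have := Hypoexponential.measureReal_lt_sum_eq_tail_of_injOn hXn_ind hXn_meas neg hXn_law
      hr_pos hr_inj ht
    simpa only [hYn] using this
  -- Step 1: adjoin the auxiliary exponential and pass to the complementary event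
  haveI := isProbabilityMeasure_expMeasure (zero_lt_one' ℝ)
  have hX_meas : Measurable fun ω => ∑ i, (lam i - 1) * u i ω :=
    Finset.measurable_sum _ fun i _ => (hmeas i).const_mul _
  rw [integral_min_one_exp_neg_eq_integral hX_meas]
  have hcompl : ∀ v, μ.real {ω | ∑ i, (lam i - 1) * u i ω ≤ v}
      = 1 - μ.real {ω | v + Yp ω < Yn ω} := by
    intro v
    have hset : {ω | ∑ i, (lam i - 1) * u i ω ≤ v} = {ω | v + Yp ω < Yn ω}ᶜ := by
      ext ω
      simp only [mem_setOf_eq, mem_compl_iff, not_lt, hX_eq ω]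
      constructor <;> intro h <;> linarith
    have hms : MeasurableSet {ω | v + Yp ω < Yn ω} :=
      measurableSet_lt (measurable_const.add hYp_meas) hYn_meas
    rw [hset, measureReal_compl hms, probReal_univ]
  -- Step 2: for `v ≥ 0`, condition on the level `v + Yp` (independent of `Yn`)
  have hindep : ∀ v : ℝ, IndepFun (fun ω => v + Yp ω) Yn μ := by
    intro v
    have h0 := hind.indepFun_finset pos neg hdisj hmeas
    have hφ : Measurable fun x : (↥pos → ℝ) => v + ∑ i : ↥pos, (1 - lam i) * x i := by fun_prop
    have hψ : Measurable fun x : (↥neg → ℝ) => ∑ i : ↥neg, (lam i - 1) * x i := by fun_prop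
    have h1 := h0.comp hφ hψ
    have e1 : ((fun x : (↥pos → ℝ) => v + ∑ i : ↥pos, (1 - lam i) * x i)
        ∘ fun (a : Ω) (i : ↥pos) => u i a) = fun ω => v + Yp ω := by
      funext ω
      simp only [Function.comp, hYp, hXp]
      rw [Finset.sum_coe_sort pos (fun i => (1 - lam i) * u i ω)]
    have e2 : ((fun x : (↥neg → ℝ) => ∑ i : ↥neg, (lam i - 1) * x i)
        ∘ fun (a : Ω) (i : ↥neg) => u i a) = Yn := by
      funext ω
      simp only [Function.comp, hYn, hXn]
      rw [Finset.sum_coe_sort neg (fun i => (lam i - 1) * u i ω)]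
    rw [e1, e2] at h1
    exact h1
  -- the exponential moments of the `λ < 1` group
  have hmgf : ∀ i ∈ neg, ∫ ω, Real.exp (-(r i * Yp ω)) ∂μ
      = ∏ j ∈ pos, (lam i - 1) / (lam i - lam j) := by
    intro i hi
    have hri : 0 < r i := hr_pos i hi
    have h1 : ∫ ω, Real.exp (-(r i * Yp ω)) ∂μ = mgf (∑ j ∈ pos, Xp j) μ (-(r i)) := by
      unfold mgf
      refine integral_congr_ae (ae_of_all _ fun ω => ?_)
      simp only [hYp, Finset.sum_apply, neg_mul]
    rw [h1, hXp_ind.mgf_sum hXp_meas pos]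
    refine Finset.prod_congr rfl fun j hj => ?_
    have hlj : lam j < 1 := (hmem_pos j).mp hj
    have hli : 1 < lam i := (hmem_neg i).mp hi
    rw [show Xp j = fun ω => (1 - lam j) * u j ω from rfl,
      mgf_const_mul_of_map_eq_expMeasure_one (hmeas j) (hlaw j) (by linarith) hri.le]
    simp only [hr]
    have h2 : lam i - 1 ≠ 0 := by linarith
    have h3 : lam i - lam j ≠ 0 := by linarith
    have hprod : (lam i - 1) * (1 + (lam i - 1)⁻¹ * (1 - lam j)) = lam i - lam j := by
      rw [mul_add, mul_one, ← mul_assoc, mul_inv_cancel₀ h2, one_mul]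
      ring
    have hA : 1 + (lam i - 1)⁻¹ * (1 - lam j) ≠ 0 := fun h => h3 (by rw [← hprod, h, mul_zero])
    rw [div_eq_div_iff hA h3, one_mul, hprod]
  -- Step 3: the conditional tail, integrated
  have hlevel : ∀ v, 0 ≤ v → μ.real {ω | v + Yp ω < Yn ω}
      = ∑ i ∈ neg, Hypoexponential.coeff neg r i * Real.exp (-(r i * v))
          * ∏ j ∈ pos, (lam i - 1) / (lam i - lam j) := by
    intro v hv
    rw [measureReal_lt_eq_integral (T := fun ω => v + Yp ω)
      (by exact measurable_const.add hYp_meas) hYn_meas (hindep v)]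
    have hae : (fun ω => (fun t => μ.real {ω' | t < Yn ω'}) (v + Yp ω))
        =ᵐ[μ] fun ω => ∑ i ∈ neg, Hypoexponential.coeff neg r i * Real.exp (-(r i * v))
          * Real.exp (-(r i * Yp ω)) := by
      filter_upwards [hYp_nn] with ω hω
      rw [htail (v + Yp ω) (by linarith), Hypoexponential.tail]
      refine Finset.sum_congr rfl fun i _ => ?_
      rw [mul_assoc, ← Real.exp_add]
      ring_nf
    rw [integral_congr_ae hae]
    have hint : ∀ i ∈ neg, Integrable (fun ω => Hypoexponential.coeff neg r i
        * Real.exp (-(r i * v)) * Real.exp (-(r i * Yp ω))) μ := by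
      intro i hi
      refine (Integrable.mono' (integrable_const (1 : ℝ)) (by fun_prop) ?_).const_mul _
      filter_upwards [hYp_nn] with ω hω
      rw [Real.norm_eq_abs, abs_of_nonneg (Real.exp_pos _).le, Real.exp_le_one_iff]
      have := hr_pos i hi
      nlinarith
    rw [integral_finsetSum _ hint]
    refine Finset.sum_congr rfl fun i hi => ?_
    rw [integral_const_mul, hmgf i hi]
  -- Step 4: integrate the level `v` against `Exp(1)`
  have hv_nn : ∀ᵐ v ∂(expMeasure 1), (0 : ℝ) ≤ v := ae_nonneg_expMeasure 1
  have hae2 : (fun v => μ.real {ω | ∑ i, (lam i - 1) * u i ω ≤ v})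
      =ᵐ[expMeasure 1] fun v => 1 - ∑ i ∈ neg, (Hypoexponential.coeff neg r i
          * ∏ j ∈ pos, (lam i - 1) / (lam i - lam j)) * Real.exp (-(r i * v)) := by
    filter_upwards [hv_nn] with v hv
    rw [hcompl v, hlevel v hv]
    congr 1
    exact Finset.sum_congr rfl fun i _ => by ring
  rw [integral_congr_ae hae2]
  have hint2 : ∀ i ∈ neg, Integrable (fun v : ℝ => (Hypoexponential.coeff neg r i
      * ∏ j ∈ pos, (lam i - 1) / (lam i - lam j)) * Real.exp (-(r i * v))) (expMeasure 1) := by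
    intro i hi
    refine (Integrable.mono' (integrable_const (1 : ℝ)) (by fun_prop) ?_).const_mul _
    filter_upwards [hv_nn] with v hv
    rw [Real.norm_eq_abs, abs_of_nonneg (Real.exp_pos _).le, Real.exp_le_one_iff]
    have := hr_pos i hi
    nlinarith
  rw [integral_sub (integrable_const _) (integrable_finsetSum _ hint2), integral_const, smul_eq_mul,
    probReal_univ, one_mul, integral_finsetSum _ hint2]
  congr 1
  refine Finset.sum_congr rfl fun i hi => ?_
  have hli : 1 < lam i := (hmem_neg i).mp hi
  rw [integral_const_mul, integral_exp_neg_mul_expMeasure one_pos (hr_pos i hi).le]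
  -- Step 5: algebra — assemble the printed weight
  have hsplit : kwWeight lam i = (∏ j ∈ pos, (lam i - 1) / (lam i - lam j))
      * ∏ j ∈ neg.erase i, (lam i - 1) / (lam i - lam j) := by
    unfold kwWeight
    rw [← Finset.prod_union (Finset.disjoint_of_subset_right (Finset.erase_subset i neg) hdisj)]
    congr 1
    ext j
    simp only [Finset.mem_erase, Finset.mem_univ, and_true, Finset.mem_union]
    constructor
    · intro hj
      by_cases h : 1 < lam j
      · exact Or.inr ⟨hj, (hmem_neg j).mpr h⟩
      · exact Or.inl ((hmem_pos j).mpr (lt_of_le_of_ne (not_lt.mp h) (hne j)))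
    · rintro (hj | ⟨hj, _⟩)
      · intro hji
        rw [hji] at hj
        have := (hmem_pos i).mp hj
        linarith
      · exact hj
  have hcoeff : Hypoexponential.coeff neg r i = ∏ j ∈ neg.erase i, (lam i - 1) / (lam i - lam j) := by
    unfold Hypoexponential.coeff
    refine Finset.prod_congr rfl fun j hj => ?_
    have hji : j ≠ i := Finset.ne_of_mem_erase hj
    simp only [hr]
    exact node_identity (hne i) (hne j) fun h => hji (hinj h).symm
  have hkey : 1 / (1 + r i) = 1 - (lam i)⁻¹ := by
    simp only [hr]
    exact one_div_one_add_inv (hpos i).ne' (hne i)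
  rw [hsplit, hcoeff, hkey]
  ring

/-- **KNECHTLI–WOLFF (4.14): the exact mean stochastic acceptance for a given spectrum.**
For independent `uᵢ ∼ Exp(1)`, `i : ι`, `n = |ι| ≥ 1`, and eigenvalues `0 < λᵢ` of `M†M`, pairwise
distinct and `≠ 1`:
`⟨w₀⟩_η = E[min(1, exp(−Σᵢ(λᵢ − 1)uᵢ))] = Σᵢ min(1, 1/λᵢ) ∏_{j≠i} (λᵢ − 1)/(λᵢ − λⱼ)`.
[cite: KnechtliWolff2003, §4.1 eqs. (4.13)–(4.14); App. A eqs. (A.16)–(A.18)] -/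
theorem integral_min_one_exp_neg_sum [Nonempty ι] {u : ι → Ω → ℝ} (hind : iIndepFun u μ)
    (hmeas : ∀ i, Measurable (u i)) (hlaw : ∀ i, μ.map (u i) = expMeasure 1)
    {lam : ι → ℝ} (hpos : ∀ i, 0 < lam i) (hne : ∀ i, lam i ≠ 1)
    (hinj : Function.Injective lam) :
    ∫ ω, min 1 (Real.exp (-(∑ i, (lam i - 1) * u i ω))) ∂μ
      = ∑ i, min 1 (lam i)⁻¹ * kwWeight lam i := by
  classical
  rw [integral_min_one_exp_neg_sum_eq_one_sub hind hmeas hlaw hpos hne hinj]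
  have hsum := sum_kwWeight hne hinj
  rw [← Finset.sum_filter_add_sum_filter_not Finset.univ (fun i => 1 < lam i) (kwWeight lam)]
    at hsum
  rw [← Finset.sum_filter_add_sum_filter_not Finset.univ (fun i => 1 < lam i)
      (fun i => min 1 (lam i)⁻¹ * kwWeight lam i)]
  have hA : ∀ i ∈ Finset.univ.filter (fun i => 1 < lam i),
      min 1 (lam i)⁻¹ * kwWeight lam i = kwWeight lam i - (1 - (lam i)⁻¹) * kwWeight lam i := by
    intro i hi
    have hli : 1 < lam i := by simpa using hi
    rw [min_eq_right (inv_le_one_of_one_le₀ hli.le)]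
    ring
  have hB : ∀ i ∈ Finset.univ.filter (fun i => ¬ 1 < lam i),
      min 1 (lam i)⁻¹ * kwWeight lam i = kwWeight lam i := by
    intro i hi
    have hli : lam i < 1 := lt_of_le_of_ne (by simpa using hi) (hne i)
    rw [min_eq_left ((one_le_inv₀ (hpos i)).mpr hli.le), one_mul]
  rw [Finset.sum_congr rfl hA, Finset.sum_congr rfl hB, Finset.sum_sub_distrib]
  linarith

/-- `Exp(1)` is a probability law (instance for the product-space corollary). [folklore] -/
private theorem isProbabilityMeasure_expMeasure_one : IsProbabilityMeasure (expMeasure 1) :=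
  isProbabilityMeasure_expMeasure one_pos

attribute [local instance] isProbabilityMeasure_expMeasure_one

/-- **(4.13) = (4.14) on the product space.** With `∏ᵢ (∫₀^∞ duᵢ e^{−uᵢ})` written as the
product probability `⊗ᵢ Exp(1)`:
`∫ min[1, exp(−Σᵢ(λᵢ − 1)uᵢ)] ∏ᵢ e^{−uᵢ}duᵢ = Σᵢ min(1, 1/λᵢ) ∏_{j≠i} (λᵢ − 1)/(λᵢ − λⱼ)`
(`min[e^{−Σuᵢ}, e^{−Σλᵢuᵢ}] = e^{−Σuᵢ} · min[1, e^{−Σ(λᵢ−1)uᵢ}]`).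
[cite: KnechtliWolff2003, §4.1 eqs. (4.13)–(4.14)] -/
theorem integral_pi_min_one_exp_neg_sum [Nonempty ι] {lam : ι → ℝ} (hpos : ∀ i, 0 < lam i)
    (hne : ∀ i, lam i ≠ 1) (hinj : Function.Injective lam) :
    ∫ u, min 1 (Real.exp (-(∑ i, (lam i - 1) * u i))) ∂(Measure.pi fun _ : ι => expMeasure 1)
      = ∑ i, min 1 (lam i)⁻¹ * kwWeight lam i := by
  have hind : iIndepFun (fun (i : ι) (u : ι → ℝ) => u i) (Measure.pi fun _ : ι => expMeasure 1) :=
    iIndepFun_pi (X := fun (_ : ι) (x : ℝ) => x) fun _ => aemeasurable_id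
  have hlaw : ∀ i, (Measure.pi fun _ : ι => expMeasure 1).map (fun u : ι → ℝ => u i) = expMeasure 1 :=
    fun i => (measurePreserving_eval (fun _ : ι => expMeasure 1) i).map_eq
  exact integral_min_one_exp_neg_sum hind (fun i => measurable_pi_apply i) hlaw hpos hne hinj

/-- **(4.13) verbatim (indices `i = 1, …, n`)**: for `n ≥ 1` and eigenvalues `0 < λᵢ` pairwise
distinct, `λᵢ ≠ 1`,
`∏ᵢ (∫₀^∞ duᵢ) min[exp(−Σᵢ uᵢ), exp(−Σᵢ λᵢ uᵢ)] = Σᵢ min(1, 1/λᵢ) ∏_{j≠i} (λᵢ − 1)/(λᵢ − λⱼ)`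
— the Lebesgue integral over the orthant `[0, ∞)ⁿ`.
[cite: KnechtliWolff2003, §4.1 eqs. (4.13)–(4.14)] -/
theorem setIntegral_min_exp_neg_sum {n : ℕ} [NeZero n] {lam : Fin n → ℝ} (hpos : ∀ i, 0 < lam i)
    (hne : ∀ i, lam i ≠ 1) (hinj : Function.Injective lam) :
    ∫ u in Set.pi Set.univ (fun _ : Fin n => Ici (0 : ℝ)),
        min (Real.exp (-(∑ i, u i))) (Real.exp (-(∑ i, lam i * u i)))
      = ∑ i, min 1 (lam i)⁻¹ * kwWeight lam i := by
  -- the product of the `Exp(1)` laws is Lebesgue measure with the product density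
  have hpi : Measure.pi (fun _ : Fin n => expMeasure 1)
      = (volume : Measure (Fin n → ℝ)).withDensity
          fun u => ENNReal.ofReal (∏ i, exponentialPDFReal 1 (u i)) :=
    pi_withDensity_eq_withDensity_prod (fun _ : Fin n => exponentialPDFReal 1)
      (fun _ => measurable_exponentialPDFReal 1) (fun _ x => exponentialPDFReal_nonneg one_pos x)
  have hdm : Measurable fun u : Fin n → ℝ => ENNReal.ofReal (∏ i, exponentialPDFReal 1 (u i)) :=
    (Finset.measurable_prod _ fun i _ =>
      (measurable_exponentialPDFReal 1).comp (measurable_pi_apply i)).ennreal_ofReal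
  rw [← integral_pi_min_one_exp_neg_sum hpos hne hinj, hpi,
    integral_withDensity_eq_integral_toReal_smul hdm (ae_of_all _ fun u => by simp),
    ← integral_indicator (MeasurableSet.univ_pi fun _ => measurableSet_Ici)]
  refine integral_congr_ae (ae_of_all _ fun u => ?_)
  simp only [smul_eq_mul]
  by_cases h : u ∈ Set.pi Set.univ (fun _ : Fin n => Ici (0 : ℝ))
  · rw [Set.indicator_of_mem h]
    have h' : ∀ i, 0 ≤ u i := fun i => Set.mem_univ_pi.mp h i
    rw [ENNReal.toReal_ofReal (Finset.prod_nonneg fun i _ => exponentialPDFReal_nonneg one_pos _)]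
    have hprod : ∏ i, exponentialPDFReal 1 (u i) = Real.exp (-(∑ i, u i)) := by
      rw [← Finset.sum_neg_distrib, Real.exp_sum]
      refine Finset.prod_congr rfl fun i _ => ?_
      rw [exponentialPDFReal_eq, if_pos (h' i), one_mul, one_mul]
    rw [hprod, mul_min_of_nonneg _ _ (Real.exp_pos _).le, mul_one, ← Real.exp_add]
    congr 2
    rw [← Finset.sum_neg_distrib, ← Finset.sum_neg_distrib, ← Finset.sum_neg_distrib,
      ← Finset.sum_add_distrib]
    exact Finset.sum_congr rfl fun i _ => by ring
  · rw [Set.indicator_of_notMem h]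
    have h' : ¬ ∀ i, 0 ≤ u i := fun h'' => h (Set.mem_univ_pi.mpr fun i => h'' i)
    obtain ⟨i, hi⟩ := not_forall.mp h'
    rw [Finset.prod_eq_zero (Finset.mem_univ i) (by rw [exponentialPDFReal_eq, if_neg hi])]
    simp

end KnechtliWolff

end Literature.MathematicalPhysics.QuantumFieldTheory.StochasticAcceptance
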